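import Summits.ResolutionOfSingularities.ResolutionOfSingularities.Theorems.FrobeniusClosingSteerBetaPolygonRounding
import Summits.ResolutionOfSingularities.ResolutionOfSingularities.Theorems.FrobeniusClosingSteerBetaPolygonGauge
import HarnessLib

/-!
# Crux `Steer` (stmt-ResolutionOfSingularities-16345), chain W4.1 — hK4′ β-leaf, K-β1♭ brick A (gauge half, TWISTED gauge `f ↦ f + u·q²`):
# the twisted orbit is an equivalence; `α*` is attained and `d!`-integral; `β` is finite on the `α*`-column

OURS (campaign `res-hironaka`, rung L ★L-G4, slot W4.1; seat res-L0-w41-stub-1 g4 = K-β1♭ owner; blueprint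
`L/res-L0-w41-stub-1/KBETA1-BLUEPRINT.md` 4807652a0eeb53d4 steps (1)–(2); words = res-L0-w41-idea-1 g10 `Sketch-idea-1-v18-hatleaf.lean` §2♭
(`IsGaugeRepTw u`, `AlphaStarGeTw`, `IsVStarTw`, res-L0-w41-plan-1 RULING 150 (1)); the plain gauge is `u = 1` (`isGaugeRepTw_one_iff`). They
replace the role of no printed item and are NOT statements of the manuscript under review [claim: Hironaka2017, status: under-review]; AI review
weaker than expert review. Theses-free, definition-free.

* `isGaugeRepTw_refl/symm/trans` (char 2: `u q² + u q′² = u (q + q′)²`), `alphaStarGeTw_anti/zero`;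
* **`exists_alphaStarTw`** — step (1) of `PrepAttainHat`/`PrepDebtHatArith`: finite twisted `α*` is an attained, `d!`-integral maximum
  (`exists_max_of_round` + `alphaGe_round` on a fixed representative);
* **`not_forall_betaGe_of_maxTw`** — step (2): on the `α*`-column of the twisted orbit every representative has finite `β`
  (`alphaGe_of_forall_betaGe`, Krull). [cite: CossartJannsenSaito2020, (11.4)] [folklore]
-/

-- `Summit.<S>.<S>.…` duplicates the summit name by design (single-problem summit).
set_option linter.dupNamespace false
set_option autoImplicit false

open IsLocalRing

namespace Summit.ResolutionOfSingularities.ResolutionOfSingularities.Theorems.SwitchingDichotomy.BetaPolygon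

variable {S : Type} [CommRing S]

/-! ## §1 The twisted orbit is an equivalence (characteristic 2) -/

/-- Every triple represents itself (`q = 0`). [folklore] -/
theorem isGaugeRepTw_refl (u x y z w f : S) : IsGaugeRepTw u x y z w f z w f :=
  ⟨by rw [sub_self]; exact Ideal.zero_mem _, by rw [sub_self]; exact Ideal.zero_mem _, ⟨0, by ring⟩⟩

/-- Symmetry in characteristic 2: `f' = f + u q² ⇒ f = f' + u q²`. [folklore] -/
theorem isGaugeRepTw_symm [CharP S 2] {u x y z w f z' w' f' : S} (h : IsGaugeRepTw u x y z w f z' w' f') :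
    IsGaugeRepTw u x y z' w' f' z w f := by
  obtain ⟨hz, hw, q, hq⟩ := h
  have h2 : (2 : S) = 0 := by simpa using CharP.cast_eq_zero S 2
  refine ⟨by rw [← neg_sub]; exact Submodule.neg_mem _ hz, by rw [← neg_sub]; exact Submodule.neg_mem _ hw, q, ?_⟩
  rw [hq, add_assoc, ← two_mul, h2, zero_mul, add_zero]

/-- Transitivity in characteristic 2: `(f + u q²) + u q'² = f + u (q + q')²`. [folklore] -/
theorem isGaugeRepTw_trans [CharP S 2] {u x y z w f z' w' f' z'' w'' f'' : S} (h : IsGaugeRepTw u x y z w f z' w' f')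
    (h' : IsGaugeRepTw u x y z' w' f' z'' w'' f'') : IsGaugeRepTw u x y z w f z'' w'' f'' := by
  obtain ⟨hz, hw, q, hq⟩ := h
  obtain ⟨hz', hw', q', hq'⟩ := h'
  refine ⟨?_, ?_, q + q', ?_⟩
  · have := Ideal.add_mem _ hz' hz; rwa [sub_add_sub_cancel] at this
  · have := Ideal.add_mem _ hw' hw; rwa [sub_add_sub_cancel] at this
  · rw [hq', hq, add_pow_char, mul_add, add_assoc]

/-- `AlphaStarGeTw` is antitone in `ρ`. [folklore] -/
theorem alphaStarGeTw_anti {u x y z w : S} {d : ℕ} {ρ ρ' : ℚ} (h : ρ ≤ ρ') {f : S} (hf : AlphaStarGeTw u x y z w d ρ' f) :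
    AlphaStarGeTw u x y z w d ρ f := by
  obtain ⟨z', w', f', hrep, hα⟩ := hf
  exact ⟨z', w', f', hrep, alphaGe_anti h hα⟩

/-- twisted `α* ≥ 0`. [folklore] -/
theorem alphaStarGeTw_zero (u x y z w : S) (d : ℕ) (f : S) : AlphaStarGeTw u x y z w d 0 f :=
  ⟨z, w, f, isGaugeRepTw_refl u x y z w f, alphaGe_zero x z w d f⟩

/-! ## §2 `α*` attained and `d!`-integral; `β` finite on the column -/

/-- **Twisted `α*` is attained and `d!`-integral** (step (1) of `PrepAttainHat` / `PrepDebtHatArith`). [cite: CossartJannsenSaito2020, (11.4)] -/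
theorem exists_alphaStarTw (u x y z w : S) {d : ℕ} (hd : 1 ≤ d) (f : S) {ρ₀ : ℚ} (hfin : ¬ AlphaStarGeTw u x y z w d ρ₀ f) :
    ∃ α : ℚ, AlphaStarGeTw u x y z w d α f ∧ (∀ ρ : ℚ, AlphaStarGeTw u x y z w d ρ f → ρ ≤ α) ∧
      ∃ m : ℕ, (d.factorial : ℚ) * α = m := by
  refine exists_max_of_round (fun ρ => AlphaStarGeTw u x y z w d ρ f) (alphaStarGeTw_zero u x y z w d f)
    (fun _ _ h hf => alphaStarGeTw_anti h hf) (fun ρ hρ => ?_) hfin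
  obtain ⟨z', w', f', hrep, hα⟩ := hρ
  obtain ⟨ρ', hρρ', hm, hα'⟩ := alphaGe_round hd hα
  exact ⟨ρ', hρρ', hm, z', w', f', hrep, hα'⟩

/-- **Step (2), twisted:** if `α = k/d!` is the maximum of the twisted star values and `(z′, w′, f′)` is a twisted representative on the column
(`AlphaGe x z′ w′ d α f′`), then `β` is finite there (Noetherian local `S`, `y ∈ 𝔪`). [cite: Matsumura1987, Thm. 8.10] -/
theorem not_forall_betaGe_of_maxTw [IsNoetherianRing S] [IsLocalRing S] {u x y z w f z' w' f' : S} (hy : y ∈ maximalIdeal S)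
    {d : ℕ} (hd : 1 ≤ d) (k : ℕ) (hmax : ∀ ρ : ℚ, AlphaStarGeTw u x y z w d ρ f → ρ ≤ (k : ℚ) / d.factorial)
    (hrep : IsGaugeRepTw u x y z w f z' w' f') : ¬ ∀ ρ : ℚ, BetaGe x y z' w' d ((k : ℚ) / d.factorial) ρ f' := by
  intro hall
  have hα' := alphaGe_of_forall_betaGe hy hd k hall
  have hle := hmax _ ⟨z', w', f', hrep, hα'⟩
  have hD : (0 : ℚ) < d.factorial := by exact_mod_cast d.factorial_pos
  have hdpos : (0 : ℚ) < d := by exact_mod_cast hd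
  have : (0 : ℚ) < 1 / ((d : ℚ) * d.factorial) := by positivity
  linarith

end Summit.ResolutionOfSingularities.ResolutionOfSingularities.Theorems.SwitchingDichotomy.BetaPolygon
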